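import Mathlib
import Literature.MathematicalPhysics.QuantumFieldTheory.Balaban1983to89.B11Reparam190

/-!
# Bałaban, *The variational problem and background fields in renormalization group method for lattice gauge
# theories*, Commun. Math. Phys. **102** (1985) 277–309, p. 306 — the (3.132)-shape letter of `(QG′Q*)⁻¹` for the NEW
# `G′ = (Δ_a − Δ⁽²⁾)⁻¹` INHERITED from the one of `(QG₀Q*)⁻¹`, `G₀ = Δ_a⁻¹`: *"Δ⁽²⁾ is a small perturbation of Δ_a, and the
# new operator G has exactly the same properties as Δ_a⁻¹"*, the `(Q·Q*)⁻¹` clause (cell GAPS G-B11-G1, residual (r1))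

CITATION HEADER (lean-in-tree rule 2026-08-18).  Source: T. Bałaban, Commun. Math. Phys. **102** (1985) 277–309,
doi:10.1007/BF01229381 [Balaban1985Variational] (cell paper B11 = [15] of [Balaban1987RG1]; held
`paper:balaban1985-cmp102-variational-background`, journal page = PDF page + 276); its ref. [5] = T. Bałaban, *Propagators for
lattice gauge theories in a background field*, Commun. Math. Phys. **99** (1985) 389–434 [Balaban1985BackgroundPropagators] (B9); its
ref. [3] = *Propagators and renormalization transformations for lattice gauge theories. II*, Commun. Math. Phys. **96** (1984) 223–250
[Balaban1984PropagatorsII] (B6).  Passages used (read in the siblings' quotations, locators theirs): p. 297 after (128) *"Δ_a = Δ +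
DRD* + Q*aQ (the constant a = 1). For the operator Δ_a⁻¹ = G we have proved Theorem 3.3 in [5], and especially the bounds (3.42)"*;
(129) *"H₀B = GQ*(QGQ*)⁻¹(L^{j(·)}η)⁻¹B"*; (131) p. 298 *"P₀ = I − GQ*(QGQ*)⁻¹Q"*; p. 306 after (179) *"defining G = (Δ_a − Δ⁽²⁾)⁻¹.
From the estimate (3.137) it follows that Δ⁽²⁾ is a small perturbation of Δ_a, and the new operator G has exactly the same properties
as Δ_a⁻¹"* (cell GAPS G-B11-G1); (180) p. 306 (`G̃ = GP₀′*` built on the new `G`); [5] p. 422 *"|(QGQ*)⁻¹(y, y′)| ≤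
O(1)(L^jη)^{−2}(L^{j′}η)^{−d}e^{−δ₁d(y,y′)} (3.132)"*, Thm 3.3 (3.42) p. 397 + p. 399, (3.137)–(3.138) p. 423; [3] (2.51)–(2.56)
pp. 232–233, Lemma 2.1 (2.61) p. 234.

WHY THIS FILE (audit cell `pub-balaban`, BINDER row (D4), OWNER lineage `b2b-balaban-beta-an4`, gen 106).  The row's NODE D at the
origin — the (190) letter of `(δ/δB)𝓗(0) = H₀ + G̃Δ⁽²⁾H₀` — was reduced by `Beta.RemainderOriginBaseLetters` (gen 105) to the BASE
LETTERS of [5] in the background field: (L1) `hH0` (there further reduced to (L2) + a (3.132)-shape letter `hInv₀` of `(QG₀Q*)⁻¹`),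
(L2) `hG0` = Thm 3.3 (3.42), first entry, for `G₀ = Δ_a⁻¹`, and **(L3) `hInv` = a (3.132)-shape letter of `(QG′Q*)⁻¹` WITH THE
NEW `G′`** — the `(Q·Q*)⁻¹` clause of p. 306's *"exactly the same properties"*, which print asserts and does not prove (cell GAPS
G-B11-G1, residual (r1); G-IF-02R).  THIS FILE DERIVES (L3) FROM (L2) AND `hInv₀` by kernel-checked bookkeeping: since
`G′ = G₀ + G₀Δ⁽²⁾G′` (the resolvent identity of p. 306), `QG′Q* = QG₀Q* + P` with the perturbation `P = Q·G₀Δ⁽²⁾G′·Q*`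
exponentially majorized with the SMALL factor `λ` of (3.137) (§2); an inverse of a perturbed operator inherits the decaying
majorant of the unperturbed inverse through the second resolvent identity `Inv′ = Inv₀ − Inv₀·P·Inv′` and the Neumann series over
block majorants (`B11SectG.neumann_majorant`, the template (3.138) of [5] ∕ *"(188) and Lemma 2.1"* of [15]) under ONE more
smallness `q_I < 1`, again proportional to `λ` (§1, §3); and in any complete normed algebra of operators the perturbed inverse
EXISTS as soon as `‖Inv₀P‖ < 1` (§4).  After this file the letter list of NODE D at the origin in a background reads: (L2) `hG0` +
`hInv₀` (the (3.132)-shape letter of `(QG₀Q*)⁻¹` — [5] p. 422 prints (3.132) for the Sect.-D operator; for `G₀ = Δ_a⁻¹` of [15]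
the tree's `QGQInverse` holds the Combes–Thomas mechanism reducing it to the kernel decay of `QG₀Q*` (⇐ Thm 3.3) and a
coercivity bound) + the localities of `Δ⁽²⁾`, `Q`, `Q*`, the source scaling + invertibility relations + TWO smallnesses in `λ` —
the assembly with `Beta.RemainderOriginBaseLetters` §§1b–6 is the sibling `Beta.RemainderOriginTwoLetters`.

* §1 `inv_fix_of_perturbation` (the second resolvent identity from `Inv₀A₀ = 1`, `(A₀ + P)Inv′ = 1`) and
  **`hasMaj_inv_of_perturbation`**: between two block-normed spaces, `Inv₀` of majorant `B_Ie^{−δ_Id}`, `P` of majorant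
  `θe^{−δ_Pd}`, `Inv′ = Inv₀ − Inv₀PInv′` a priori bounded, `q = κ₁(κ₂B_Iθc)c < 1` ⟹ `Inv′` has the majorant `B_I(1 − q)⁻¹e^{−ρd}`
  for `ρ + σ ≤ δ_P`, `ρ + 2σ ≤ δ_I` (two row sums of Lemma 2.1 [3]).
* §2 `qgq_newG_apply` (`QG′Q* = QG₀Q* + Q·G₀Δ⁽²⁾G′·Q*` pointwise) and **`hasMaj_qgq_perturbation`**: the majorant
  `θ_P·e^{−ρ₁d}` of `P = Q·G₀Δ⁽²⁾G′·Q*` from `hG0`, a LOCAL `Δ⁽²⁾` (range `r_D`, column sums `≤ λ`), the first entry of `G′`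
  (`Beta.RemainderOriginBaseLetters.hasMaj_newG_of_fix_local`, here a hypothesis `hG'`), and LOCAL `Q`, `Q*` (range `r_Q`, row ∕ column
  sums `ν_Q`, `ν_{Q*}`): `θ_P = κ_N²κ₃²·Bλe^{δ₁r_D}·B_{G′}·ν_Qν_{Q*}e^{2ρ₁r_Q}·c` — LINEAR IN `λ`.
* §3 **`hasMaj_invQGQ_newG`**: (L3) from `hInv₀` + §2 + §1 — `(QG′Q*)⁻¹` has the majorant `B_I(1 − q_I)⁻¹e^{−ρd}`,
  `q_I = κ_{Q′}κ_QB_Iθ_Pc²`, for `ρ + σ ≤ ρ₁ ≤ δ_{G′}`, `ρ₁ + σ ≤ δ₁`, `ρ + 2σ ≤ δ_I`.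
* §4 **`exists_inv_of_perturbation`**: in a normed ring with summable geometric series (e.g. the bounded operators of a Banach
  space), `Inv₀A₀ = 1 = A₀Inv₀` and `‖Inv₀P‖ < 1` ⟹ `∃ Inv′`, `Inv′(A₀ + P) = 1 = (A₀ + P)Inv′`, `Inv′ = Inv₀ − Inv₀PInv′` —
  the existence half of p. 306's sentence for `(QG′Q*)⁻¹` (Mathlib `isUnit_one_sub_of_norm_lt_one`).

HONEST SCOPE.  [folklore] compositions of the siblings' kernel-checked majorant lemmas (`B11SectG`, `B11Reparam190`) and one
Neumann-series unit in a Banach algebra; NO estimate of [5] or [15] is proved; `hInv₀`, `hG0` stay hypotheses of the printed SHAPE;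
nothing identifies Bałaban's step-`k` operators `Δ_a`, `Δ⁽²⁾`, `Q`, `Q*` with tree terms (NODE O); the rate bookkeeping and the
constants are this file's, absorbed in print's *"O(1)"*, *"δ₁"* (cell DIVERGENCE D-B11-25).  Row (D4) class UNCHANGED (instance 0∕1;
D4 DISCHARGE NO DATE); NOT B12 Thm 2, NOT BetaPertH, NOT continuum, NOT Clay.  HONEST DEPENDENCY (cell line): continuum YM on T⁴ ⇐
BetaPertH ∧ nine spine estimates (0/9 proved); BetaPertH ⇐ (D1) ∧ (D4) ∧ CAP+tail; G-an2-4 gates asym, D1 and NE2/3/4.  NEW file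
importing `B11Reparam190` only; nothing modified; 0 `def`; standard axioms; no `sorry`.
-/

namespace Literature.MathematicalPhysics.QuantumFieldTheory.Balaban1983to89.Beta.RemainderInvQGQNewG

open Literature.MathematicalPhysics.QuantumFieldTheory.Balaban1983to89
open Finset B6RandomWalk B11SectG B11Reparam190

variable {g : B6.Geometry}

/-! ## §1  The inverse of a perturbed operator inherits the decaying majorant of the unperturbed inverse -/

section Perturbation

variable {F₁ F₂ : Type} [AddCommGroup F₁] [Module ℝ F₁] [AddCommGroup F₂] [Module ℝ F₂]

/-- **THE SECOND RESOLVENT IDENTITY.**  If `Inv₀` is a left inverse of `A₀` and `Inv′` a right inverse of the perturbed operator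
`A₀ + P`, then `Inv′ = Inv₀ − Inv₀·P·Inv′` (`Inv₀(A₀ + P)Inv′ = Inv₀`).  For p. 306: `A₀ = QG₀Q*`, `A₀ + P = QG′Q*` with
`P = Q·G₀Δ⁽²⁾G′·Q*` (§2). [cite: Balaban1985Variational, p.306 after (179), (131) p.298] -/
theorem inv_fix_of_perturbation {A0 P : F₁ →ₗ[ℝ] F₂} {Inv0 Inv' : F₂ →ₗ[ℝ] F₁}
    (hleft : Inv0 ∘ₗ A0 = LinearMap.id) (hright : (A0 + P) ∘ₗ Inv' = LinearMap.id) :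
    Inv' = Inv0 - (Inv0 ∘ₗ P) ∘ₗ Inv' := by
  have h : Inv0 ∘ₗ ((A0 + P) ∘ₗ Inv') = Inv0 := by rw [hright, LinearMap.comp_id]
  rw [LinearMap.add_comp, LinearMap.comp_add] at h
  have h1 : Inv0 ∘ₗ (A0 ∘ₗ Inv') = Inv' := by rw [← LinearMap.comp_assoc, hleft, LinearMap.id_comp]
  rw [h1] at h
  -- h : Inv' + Inv0 ∘ₗ (P ∘ₗ Inv') = Inv0
  rw [LinearMap.comp_assoc]
  exact eq_sub_of_add_eq h

/-- **THE INVERSE OF A PERTURBED OPERATOR INHERITS THE DECAYING MAJORANT, TWO ROW SUMS** — the template (3.138) of [5] ∕ *"(188)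
and Lemma 2.1"* of [15] (`B11SectG.neumann_majorant`) for the second resolvent identity.  Between the block-normed spaces `b₁` (of
`F₁`) and `b₂` (of `F₂`): `Inv₀ : F₂ → F₁` has the majorant `B_Ie^{−δ_Id}` (`b₂ → b₁`), the perturbation `P : F₁ → F₂` the
majorant `θe^{−δ_Pd}` (`b₁ → b₂`), `Inv′ : F₂ → F₁` solves `Inv′ = Inv₀ − Inv₀·P·Inv′` and is A PRIORI bounded (majorant the
constant `M₀` — automatic on finite carriers, `Beta.RemainderOriginBaseLetters.hasMaj_supSize_const_of_opNorm`), the row sum (2.61) of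
Lemma 2.1 [3] holds at the rate `σ ≥ 0` with constant `c ≥ 0`, and `q := κ₁·(κ₂B_Iθc)·c < 1`.  Then `Inv′` has the majorant
`B_I(1 − q)⁻¹e^{−ρd}` from `b₂` into `b₁` for every `ρ ≥ 0` with `ρ + σ ≤ δ_P`, `ρ + 2σ ≤ δ_I` (`Inv₀P` costs one row sum, the
series another).  (`Beta.RemainderOriginBaseLetters.hasMaj_newG_of_fix_exp` is the same statement for the first resolvent identity
`G′ = G₀ + G₀Δ⁽²⁾G′`.) [cite: Balaban1985Variational, p.306 after (179), (187)–(188) p.308; Balaban1985BackgroundPropagators, (3.132) p.422, (3.137)–(3.138) p.423; Balaban1984PropagatorsII, (2.54) p.233, Lemma 2.1 (2.61) p.234] -/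
theorem hasMaj_inv_of_perturbation {b₁ : BlockNorm g F₁} {b₂ : BlockNorm g F₂}
    {Inv0 Inv' : F₂ →ₗ[ℝ] F₁} {P : F₁ →ₗ[ℝ] F₂} {BI θ M₀ δI δP ρ σ c : ℝ}
    (htri : Triangle254 g) (hd : ∀ a b : g.Site, 0 ≤ g.dist a b) (hrow : RowSum g σ c) (hc : 0 ≤ c)
    (hBI : 0 ≤ BI) (hθ : 0 ≤ θ) (hM₀ : 0 ≤ M₀) (hρ : 0 ≤ ρ) (hσ : 0 ≤ σ) (hρP : ρ + σ ≤ δP) (hρI : ρ + 2 * σ ≤ δI)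
    (hInv0 : HasMaj b₂ b₁ Inv0 (fun a b => BI * Real.exp (-(δI * g.dist a b))))
    (hP : HasMaj b₁ b₂ P (fun a b => θ * Real.exp (-(δP * g.dist a b))))
    (hfix : Inv' = Inv0 - (Inv0 ∘ₗ P) ∘ₗ Inv') (hap : HasMaj b₂ b₁ Inv' (fun _ _ => M₀))
    (hq : b₁.κ * (b₂.κ * BI * θ * c) * c < 1) :
    HasMaj b₂ b₁ Inv'
      (fun a b => BI * (1 - b₁.κ * (b₂.κ * BI * θ * c) * c)⁻¹ * Real.exp (-(ρ * g.dist a b))) := by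
  -- K′ = −Inv₀P : b₁ → b₁ at the rate ρ + σ (first row sum)
  have hK : HasMaj b₁ b₁ (-(Inv0 ∘ₗ P))
      (fun a b => b₂.κ * BI * θ * c * Real.exp (-((ρ + σ) * g.dist a b))) :=
    (hasMaj_comp_exp htri hd hrow hBI hθ (by linarith) hρP (by linarith) hInv0 hP).neg
  have hθ' : 0 ≤ b₂.κ * BI * θ * c := mul_nonneg (mul_nonneg (mul_nonneg b₂.κ_nonneg hBI) hθ) hc
  have hfix' : Inv' = Inv0 + (-(Inv0 ∘ₗ P)) ∘ₗ Inv' := by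
    rw [LinearMap.neg_comp, ← sub_eq_add_neg]; exact hfix
  exact neumann_majorant htri hd hrow hθ' hBI hM₀ hρ le_rfl hK (hInv0.of_rate_le hd hBI (by linarith)) hfix' hap hq

end Perturbation

/-! ## §2  p. 306: `QG′Q* = QG₀Q* + Q·G₀Δ⁽²⁾G′·Q*` and the majorant of the perturbation — linear in the (3.137) factor `λ` -/

section QGQ

variable {FA F3 FQ : Type} [AddCommGroup FA] [Module ℝ FA] [AddCommGroup F3] [Module ℝ F3]
  [AddCommGroup FQ] [Module ℝ FQ]

/-- **`QG′Q* = QG₀Q* + Q·G₀Δ⁽²⁾G′·Q*`** from the resolvent identity `G′ = G₀ + G₀Δ⁽²⁾G′` of the new `G′ = (Δ_a − Δ⁽²⁾)⁻¹`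
(`Beta.RemainderOriginBaseLetters.newG_fix_of_inverse`), pointwise. [cite: Balaban1985Variational, p.306 after (179), (131) p.298] -/
theorem qgq_newG_apply {G0 G' : F3 →ₗ[ℝ] FA} {D2 : FA →ₗ[ℝ] F3} {Q : FA →ₗ[ℝ] FQ} {Qs : FQ →ₗ[ℝ] F3}
    (hfix : G' = G0 + (G0 ∘ₗ D2) ∘ₗ G') (v : FQ) :
    ((Q ∘ₗ G') ∘ₗ Qs) v = ((Q ∘ₗ G0) ∘ₗ Qs) v + (Q ∘ₗ (((G0 ∘ₗ D2) ∘ₗ G') ∘ₗ Qs)) v := by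
  have hpt : ∀ u : F3, G' u = G0 u + G0 (D2 (G' u)) := fun u => by
    conv_lhs => rw [hfix]
    rfl
  simp only [LinearMap.comp_apply]
  conv_lhs => rw [hpt (Qs v)]
  rw [map_add]

/-- The same as an identity of linear maps: `QG′Q* = QG₀Q* + P`, `P = Q·G₀Δ⁽²⁾G′·Q*`. [cite: Balaban1985Variational, p.306 after (179)] -/
theorem qgq_newG_eq {G0 G' : F3 →ₗ[ℝ] FA} {D2 : FA →ₗ[ℝ] F3} {Q : FA →ₗ[ℝ] FQ} {Qs : FQ →ₗ[ℝ] F3}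
    (hfix : G' = G0 + (G0 ∘ₗ D2) ∘ₗ G') :
    (Q ∘ₗ G') ∘ₗ Qs = (Q ∘ₗ G0) ∘ₗ Qs + Q ∘ₗ (((G0 ∘ₗ D2) ∘ₗ G') ∘ₗ Qs) :=
  LinearMap.ext fun v => qgq_newG_apply hfix v

/-- **THE MAJORANT OF THE PERTURBATION `P = Q·G₀Δ⁽²⁾G′·Q*`.**  Setting ((115): `Δ_a : FA → F3`, so `G₀, G′ : F3 → FA`,
`Δ⁽²⁾ : FA → F3`; `Q : FA → FQ`, `Q* : FQ → F3`; block sizes `b3`, `bN` of the sources ∕ fields and TWO sizes `bQ`, `bQ′` of the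
`Q`-images, the weights of (3.132) absorbed in them): `G₀` of majorant `Be^{−δ₁d}` ([5] Thm 3.3 (3.42), first entry, for
`Δ_a⁻¹` — p. 297), `Δ⁽²⁾` LOCAL of range `r_D` with column sums `≤ λ` ((3.137): *"a small perturbation"*), `G′` of majorant
`B_{G′}e^{−δ_{G′}d}` (the first entry of the new `G′`, `Beta.RemainderOriginBaseLetters.hasMaj_newG_of_fix_local`), `Q` LOCAL
(range `r_Q`, row sums `≤ ν_Q`; `bN → bQ`) and `Q*` LOCAL (range `r_Q`, column sums `≤ ν_{Q*}`; `bQ′ → b3`); (2.54) and the row sum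
(2.61) of Lemma 2.1 [3] at the rate `σ` with constant `c`.  Then for every `ρ₁ ≥ 0` with `ρ₁ ≤ δ_{G′}`, `ρ₁ + σ ≤ δ₁` the
perturbation `P : FQ → FQ` has the majorant `θ_P·e^{−ρ₁d}` from `bQ′` into `bQ` with
`θ_P = κ_N·(κ₃·(κ_N·(κ₃Bλe^{δ₁r_D})·B_{G′}·c)·ν_{Q*}e^{ρ₁r_Q})·ν_Qe^{ρ₁r_Q}` — the three local factors cost no rate
(`B11Reparam190.hasMaj_comp_localRight` ∕ `…Left`), ONE row sum between `G₀Δ⁽²⁾` and `G′`.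
[cite: Balaban1985Variational, p.306 after (179), (115) p.294, p.297, (131) p.298; Balaban1985BackgroundPropagators, Thm 3.3 (3.42) p.397+p.399, (3.137) p.423; Balaban1984PropagatorsII, (2.52)–(2.56) pp.232–233, Lemma 2.1 (2.61) p.234] -/
theorem hasMaj_qgq_perturbation {b3 : BlockNorm g F3} {bN : BlockNorm g FA} {bQ bQ' : BlockNorm g FQ}
    {G0 G' : F3 →ₗ[ℝ] FA} {D2 : FA →ₗ[ℝ] F3} {Q : FA →ₗ[ℝ] FQ} {Qs : FQ →ₗ[ℝ] F3}
    {KD KQ KQs : g.Site → g.Site → ℝ} {B BG' δ₁ δG' ρ₁ σ c rD lam rQ νQ νs : ℝ}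
    (htri : Triangle254 g) (hd : ∀ a b : g.Site, 0 ≤ g.dist a b) (hrow : RowSum g σ c) (hc : 0 ≤ c)
    (hB : 0 ≤ B) (hBG' : 0 ≤ BG') (hlam : 0 ≤ lam) (hνs : 0 ≤ νs)
    (hσ : 0 ≤ σ) (hρ₁ : 0 ≤ ρ₁) (hρ₁G : ρ₁ ≤ δG') (hρ₁δ : ρ₁ + σ ≤ δ₁)
    (hKD : ∀ a b, 0 ≤ KD a b) (hDloc : ∀ a b, KD a b ≠ 0 → g.dist a b ≤ rD)
    (hDcol : ∀ b, ∑ a : g.Site, KD a b ≤ lam) (hD2 : HasMaj bN b3 D2 KD)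
    (hG0 : HasMaj b3 bN G0 (fun a b => B * Real.exp (-(δ₁ * g.dist a b))))
    (hG' : HasMaj b3 bN G' (fun a b => BG' * Real.exp (-(δG' * g.dist a b))))
    (hKQ : ∀ a b, 0 ≤ KQ a b) (hQloc : ∀ a b, KQ a b ≠ 0 → g.dist a b ≤ rQ)
    (hQrow : ∀ a, ∑ b : g.Site, KQ a b ≤ νQ) (hQ : HasMaj bN bQ Q KQ)
    (hKQs : ∀ a b, 0 ≤ KQs a b) (hQsloc : ∀ a b, KQs a b ≠ 0 → g.dist a b ≤ rQ)
    (hQscol : ∀ b, ∑ a : g.Site, KQs a b ≤ νs) (hQs : HasMaj bQ' b3 Qs KQs) :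
    HasMaj bQ' bQ (Q ∘ₗ (((G0 ∘ₗ D2) ∘ₗ G') ∘ₗ Qs))
      (fun a b => bN.κ * (b3.κ * (bN.κ * (b3.κ * B * lam * Real.exp (δ₁ * rD)) * BG' * c) * νs *
          Real.exp (ρ₁ * rQ)) * νQ * Real.exp (ρ₁ * rQ) * Real.exp (-(ρ₁ * g.dist a b))) := by
  have hδ₁ : 0 ≤ δ₁ := by linarith
  -- G₀Δ⁽²⁾ : bN → bN at the rate δ₁ (local factor on the right: no rate lost)
  have h1 : HasMaj bN bN (G0 ∘ₗ D2)
      (fun a b => b3.κ * B * lam * Real.exp (δ₁ * rD) * Real.exp (-(δ₁ * g.dist a b))) :=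
    hasMaj_comp_localRight htri hB hδ₁ hKD hDloc hDcol hG0 hD2
  have ha₁ : 0 ≤ b3.κ * B * lam * Real.exp (δ₁ * rD) :=
    mul_nonneg (mul_nonneg (mul_nonneg b3.κ_nonneg hB) hlam) (Real.exp_nonneg _)
  -- (G₀Δ⁽²⁾)G′ : b3 → bN at the rate ρ₁ (one row sum)
  have h2 : HasMaj b3 bN ((G0 ∘ₗ D2) ∘ₗ G')
      (fun a b => bN.κ * (b3.κ * B * lam * Real.exp (δ₁ * rD)) * BG' * c * Real.exp (-(ρ₁ * g.dist a b))) :=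
    hasMaj_comp_exp htri hd hrow ha₁ hBG' hρ₁ hρ₁G hρ₁δ h1 hG'
  have ha₂ : 0 ≤ bN.κ * (b3.κ * B * lam * Real.exp (δ₁ * rD)) * BG' * c :=
    mul_nonneg (mul_nonneg (mul_nonneg bN.κ_nonneg ha₁) hBG') hc
  -- (G₀Δ⁽²⁾G′)Q* : bQ′ → bN at the rate ρ₁ (local factor on the right)
  have h3 : HasMaj bQ' bN (((G0 ∘ₗ D2) ∘ₗ G') ∘ₗ Qs)
      (fun a b => b3.κ * (bN.κ * (b3.κ * B * lam * Real.exp (δ₁ * rD)) * BG' * c) * νs * Real.exp (ρ₁ * rQ) *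
        Real.exp (-(ρ₁ * g.dist a b))) :=
    hasMaj_comp_localRight htri ha₂ hρ₁ hKQs hQsloc hQscol h2 hQs
  have ha₃ : 0 ≤ b3.κ * (bN.κ * (b3.κ * B * lam * Real.exp (δ₁ * rD)) * BG' * c) * νs * Real.exp (ρ₁ * rQ) :=
    mul_nonneg (mul_nonneg (mul_nonneg b3.κ_nonneg ha₂) hνs) (Real.exp_nonneg _)
  -- Q(G₀Δ⁽²⁾G′Q*) : bQ′ → bQ at the rate ρ₁ (local factor on the left)
  exact hasMaj_comp_localLeft htri ha₃ hρ₁ hKQ hQloc hQrow hQ h3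

end QGQ

/-! ## §3  (L3) from (L2) + `hInv₀`: the (3.132)-shape letter of `(QG′Q*)⁻¹` for the new `G′` -/

section InvQGQ

variable {FA F3 FQ : Type} [AddCommGroup FA] [Module ℝ FA] [AddCommGroup F3] [Module ℝ F3]
  [AddCommGroup FQ] [Module ℝ FQ]

/-- **p. 306, THE `(QGQ*)⁻¹` CLAUSE OF *"the new operator G has exactly the same properties as Δ_a⁻¹"*, KERNEL-CHECKED MODULO
THE BASE LETTERS.**  Setting of `hasMaj_qgq_perturbation`, plus: `Inv₀ = (QG₀Q*)⁻¹` of majorant `B_Ie^{−δ_Id}` from `bQ` into `bQ′`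
— the SHAPE of [5] (3.132) for `G₀ = Δ_a⁻¹` (`hInv0`; the weights `(L^jη)^{−2}(L^{j′}η)^{−d}` absorbed in the two sizes); `Inv′`
solving the second resolvent identity `Inv′ = Inv₀ − Inv₀·P·Inv′` with `P = Q·G₀Δ⁽²⁾G′·Q*` (`inv_fix_of_perturbation`: it holds for
`Inv′ = (QG′Q*)⁻¹` as soon as `Inv₀QG₀Q* = 1` and `QG′Q*·Inv′ = 1`) and a priori bounded (majorant the constant `M_I`); and the
second smallness `q_I := κ_{Q′}·(κ_QB_Iθ_Pc)·c < 1`, `θ_P` the constant of `hasMaj_qgq_perturbation` at the rate `ρ₁` — LINEAR IN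
the (3.137) factor `λ`, so again *"Δ⁽²⁾ is a small perturbation of Δ_a"*.  CONCLUSION: for every `ρ ≥ 0` with `ρ + σ ≤ ρ₁`,
`ρ₁ ≤ δ_{G′}`, `ρ₁ + σ ≤ δ₁`, `ρ + 2σ ≤ δ_I`, the operator `Inv′` has the majorant `B_I(1 − q_I)⁻¹e^{−ρd}` from `bQ` into `bQ′` —
the `hInv` letter of `Beta.RemainderOriginBaseLetters.hasMaj_tildeG_of_newG` ∕ `ineq190_origin_of_base_letters` ∕ `ineq190_origin_supSize`,
now DERIVED from `hG0` and `hInv0`; `θ_P` and `q_I` are bound to their closed forms by `hθP`, `hqI` (instantiate with `rfl`).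
[cite: Balaban1985Variational, p.306 after (179), (129)–(131) pp.297–298, (180) p.306; Balaban1985BackgroundPropagators, (3.132) p.422, Thm 3.3 (3.42) p.397+p.399, (3.137)–(3.138) p.423; Balaban1984PropagatorsII, (2.54) p.233, Lemma 2.1 (2.61) p.234] -/
theorem hasMaj_invQGQ_newG {b3 : BlockNorm g F3} {bN : BlockNorm g FA} {bQ bQ' : BlockNorm g FQ}
    {G0 G' : F3 →ₗ[ℝ] FA} {D2 : FA →ₗ[ℝ] F3} {Q : FA →ₗ[ℝ] FQ} {Qs : FQ →ₗ[ℝ] F3} {Inv0 Inv' : FQ →ₗ[ℝ] FQ}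
    {KD KQ KQs : g.Site → g.Site → ℝ} {B BG' BI MI δ₁ δG' δI ρ₁ ρ σ c rD lam rQ νQ νs θP qI : ℝ}
    (htri : Triangle254 g) (hd : ∀ a b : g.Site, 0 ≤ g.dist a b) (hrow : RowSum g σ c) (hc : 0 ≤ c)
    (hB : 0 ≤ B) (hBG' : 0 ≤ BG') (hBI : 0 ≤ BI) (hMI : 0 ≤ MI) (hlam : 0 ≤ lam) (hνQ : 0 ≤ νQ) (hνs : 0 ≤ νs)
    (hσ : 0 ≤ σ) (hρ : 0 ≤ ρ) (hρρ₁ : ρ + σ ≤ ρ₁) (hρ₁G : ρ₁ ≤ δG') (hρ₁δ : ρ₁ + σ ≤ δ₁) (hρI : ρ + 2 * σ ≤ δI)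
    (hKD : ∀ a b, 0 ≤ KD a b) (hDloc : ∀ a b, KD a b ≠ 0 → g.dist a b ≤ rD)
    (hDcol : ∀ b, ∑ a : g.Site, KD a b ≤ lam) (hD2 : HasMaj bN b3 D2 KD)
    (hG0 : HasMaj b3 bN G0 (fun a b => B * Real.exp (-(δ₁ * g.dist a b))))
    (hG' : HasMaj b3 bN G' (fun a b => BG' * Real.exp (-(δG' * g.dist a b))))
    (hKQ : ∀ a b, 0 ≤ KQ a b) (hQloc : ∀ a b, KQ a b ≠ 0 → g.dist a b ≤ rQ)
    (hQrow : ∀ a, ∑ b : g.Site, KQ a b ≤ νQ) (hQ : HasMaj bN bQ Q KQ)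
    (hKQs : ∀ a b, 0 ≤ KQs a b) (hQsloc : ∀ a b, KQs a b ≠ 0 → g.dist a b ≤ rQ)
    (hQscol : ∀ b, ∑ a : g.Site, KQs a b ≤ νs) (hQs : HasMaj bQ' b3 Qs KQs)
    (hInv0 : HasMaj bQ bQ' Inv0 (fun a b => BI * Real.exp (-(δI * g.dist a b))))
    (hfixI : Inv' = Inv0 - (Inv0 ∘ₗ (Q ∘ₗ (((G0 ∘ₗ D2) ∘ₗ G') ∘ₗ Qs))) ∘ₗ Inv')
    (hapI : HasMaj bQ bQ' Inv' (fun _ _ => MI))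
    (hθP : θP = bN.κ * (b3.κ * (bN.κ * (b3.κ * B * lam * Real.exp (δ₁ * rD)) * BG' * c) * νs *
      Real.exp (ρ₁ * rQ)) * νQ * Real.exp (ρ₁ * rQ))
    (hqI : qI = bQ'.κ * (bQ.κ * BI * θP * c) * c) (hq : qI < 1) :
    HasMaj bQ bQ' Inv' (fun a b => BI * (1 - qI)⁻¹ * Real.exp (-(ρ * g.dist a b))) := by
  have hρ₁ : 0 ≤ ρ₁ := by linarith
  -- §2: the perturbation at the rate ρ₁
  have hP := hasMaj_qgq_perturbation htri hd hrow hc hB hBG' hlam hνs hσ hρ₁ hρ₁G hρ₁δ hKD hDloc hDcol hD2 hG0 hG'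
    hKQ hQloc hQrow hQ hKQs hQsloc hQscol hQs
  have hθP0 : 0 ≤ θP := by
    rw [hθP]
    have := bN.κ_nonneg; have := b3.κ_nonneg
    positivity
  -- §1: the perturbed inverse
  have h := hasMaj_inv_of_perturbation (b₁ := bQ') (b₂ := bQ) htri hd hrow hc hBI hθP0 hMI hρ hσ hρρ₁ hρI hInv0
    (by rw [hθP]; exact hP) hfixI hapI (by rw [← hqI]; exact hq)
  rw [hqI]
  exact h

end InvQGQ

/-! ## §4  Existence: in a complete normed algebra the perturbed inverse exists as soon as `‖Inv₀P‖ < 1` -/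

section Existence

variable {R : Type*} [NormedRing R] [HasSummableGeomSeries R]

/-- **THE PERTURBED INVERSE EXISTS** (the existence half of p. 306's *"the new operator … has exactly the same properties"* for
`(QG′Q*)⁻¹`): in a normed ring with summable geometric series — e.g. the bounded operators of a Banach space — if `Inv₀` is a
two-sided inverse of `A₀` and `‖Inv₀P‖ < 1`, then `1 + Inv₀P` is a unit (Mathlib `isUnit_one_sub_of_norm_lt_one`),
`Inv′ := (1 + Inv₀P)⁻¹Inv₀` is a two-sided inverse of `A₀ + P` (`A₀ + P = A₀(1 + Inv₀P)`), and it solves the second resolvent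
identity `Inv′ = Inv₀ − Inv₀PInv′`. [cite: Balaban1985Variational, p.306 after (179), (187)–(188) p.308] -/
theorem exists_inv_of_perturbation (A0 P Inv0 : R) (hleft : Inv0 * A0 = 1) (hright : A0 * Inv0 = 1)
    (hq : ‖Inv0 * P‖ < 1) :
    ∃ Inv' : R, Inv' * (A0 + P) = 1 ∧ (A0 + P) * Inv' = 1 ∧ Inv' = Inv0 - Inv0 * P * Inv' := by
  obtain ⟨u, hu⟩ := isUnit_one_sub_of_norm_lt_one (x := -(Inv0 * P)) (by rwa [norm_neg])
  rw [sub_neg_eq_add] at hu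
  refine ⟨(↑u⁻¹ : R) * Inv0, ?_, ?_, ?_⟩
  · -- u⁻¹Inv₀(A₀ + P) = u⁻¹(1 + Inv₀P) = 1
    rw [mul_assoc, mul_add, hleft, ← hu, Units.inv_mul]
  · -- (A₀ + P)u⁻¹Inv₀ = A₀(1 + Inv₀P)u⁻¹Inv₀ = A₀Inv₀ = 1
    have e1 : A0 + P = A0 * (1 + Inv0 * P) := by
      rw [mul_add, mul_one, ← mul_assoc, hright, one_mul]
    rw [e1, ← hu, mul_assoc, ← mul_assoc (↑u : R), Units.mul_inv, one_mul, hright]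
  · -- (1 + Inv₀P)Inv′ = Inv₀
    have e2 : (1 + Inv0 * P) * ((↑u⁻¹ : R) * Inv0) = Inv0 := by
      rw [← hu, ← mul_assoc, Units.mul_inv, one_mul]
    rw [add_mul, one_mul] at e2
    exact eq_sub_of_add_eq e2

end Existence

end Literature.MathematicalPhysics.QuantumFieldTheory.Balaban1983to89.Beta.RemainderInvQGQNewG
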